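import Summits.BirchSwinnertonDyer.BirchSwinnertonDyer.Theorems.BiquadraticEisensteinDescentEisensteinHeartFlatCMInertBadKPrimeSqrtEndomorphismTwist
import HarnessLib

set_option linter.dupNamespace false -- `Summit.BirchSwinnertonDyer.BirchSwinnertonDyer.Theorems.…` (summit = sub)
set_option autoImplicit false

/-!
# Crux `EisensteinHeartFlatCMInertBadKPrime` (stmt-BirchSwinnertonDyer-21341), line `hsieh-lambda`, stub `stub_sqrtEndomorphism` —
# CM endomorphisms of EVEN degree in Galois sign form: `[√-2]` on every curve with `j = 8000` (`End = ℤ[√-2]`) and `[2i] = [√-4]` on every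
# curve with `j = 287496` (`End = ℤ[2i]`), over a field of characteristic `0` not containing `√-2` (resp. `i`)

Route `BiquadraticEisensteinDescent` (cell `pub/bsd-wall`, width-prover seat `bsd-wall-cm-bed-w4` g7). Third companion of `…SqrtEndomorphismTwist`
(w1 g5). For the CM orders `ℤ[√-2]` (`j = 8000`) and `ℤ[2i]` (`j = 287496`) every trace-zero element has EVEN norm (`2k²`, `4k²`), so the
sign-form CM endomorphism `ψ` (`σψσ⁻¹ = -ψ` off `Stab(√d)` forces trace zero) is `[√-2]` of degree `2`, resp. `[2i]` of degree `4`: its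
`x`-coordinate map `N/D` has a NON-square denominator `D = ∏_{Q ∈ ker∖0} (x - x_Q)` (a `2`-torsion point occurs once). The tree's standard
form `(U/h², (S y + T)/h³)` (`IsogenyFormula`, *AEC* Remark III.4.13.3) still holds after PADDING — `U = g·N`, `h` with `h² = g·D` — because
its two identities are consequences of the curve equation; only the degree lemma `IsogenyFormula.deg_toIsogeny` (which reads `deg φ = deg U`
off a COPRIME pair `U, h`) is lost. This file replaces it:

* §1 `deg_toIsogeny_of_repr` — `deg φ = max (deg a) (deg b)` for any coprime `a, b ∈ K̄[X]` and `g ≠ 0` with `U = g a`, `h² = g b`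
  (the tree's representation-free `Isogeny.deg_eq_max_natDegree_of_pullbackX_eq` + `IsogenyFormula.pullbackX_toIsogeny`; `g(x) ≠ 0` in
  `K̄(E)` since `x` is transcendental); `deg_sqrtEndo_of_repr` — the same for the twisted endomorphism `[√d] = τ ∘ φ` of `CMSqrtEndomorphism`
  (`h ↦ √d·h` multiplies `b` by the unit `d`);
* §2 `sqrtEndo_comp_self_of_deg` — **`[√d] ∘ [√d] = [-n]`** on `E(F̄)` from `deg [√d] = n > 0` and an automorphism `σ` of `F̄` with `σ √d = -√d`
  fixing `W, U, h, S`: the tree's proof of `IsogenyFormula.sqrtEndo_comp_self` VERBATIM (Cor. III.6.3: `ψ² - tψ + deg ψ = 0`; conjugation by `σ`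
  flips `t`; `t = 0`) with the degree supplied as a hypothesis instead of through coprimality;
* §3 `exists_sqrt_endomorphism_of_repr` — the Galois-action form over a base `F ∌ √d` (w1's `…SqrtEndomorphism.exists_sqrt_endomorphism`
  VERBATIM, reading everything over `Ω = F̄` and lifting `σ ∈ Γ_F` to `\overline{Ω}`) from a coprime representation `(g, a, b)` over `F`;
* §4 `exists_sqrt_endomorphism_of_j_eq_8000` — model `E = [0,0,0,-30,56]` (`j = 8000`), the `2`-isogeny with kernel `⟨(4,0)⟩ = E[√-2]` onto
  `E^{(-2)} = [0,0,0,-120,-448]` (Vélu: `x ↦ (x² - 4x + 18)/(x - 4)`, `y ↦ y (x² - 8x - 2)/(x - 4)²`), padded with `g = X - 4`: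
  `U = X³ - 8X² + 34X - 72`, `h = X - 4`, `S = X³ - 12X² + 30X + 8` (inline `IsogenyCert` literal, `check` by `decide`), `a = X² - 4X + 18`,
  `b = X - 4` (`a - X b = 18`), degree `2`: on every `V/K` with `j(V) = 8000`, `r² = -2`, `σ₀ r = -r` ⊢ `ψ` with the sign rules and `ψ ∘ ψ = [-2]`;
* §5 `exists_sqrt_endomorphism_of_j_eq_287496` — model `E = [0,0,0,-11,-14]` (`32a3`, `j = 287496 = 66³`), the CYCLIC `4`-isogeny with kernel
  `E[2i] = {O, (-2,0), (-3, ±2√-2)}` onto `E^{(-1)} = [0,0,0,-11,14]` (`32a4`), composite of `E → E/⟨(-2,0)⟩` (`j = 1728`) and a second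
  `2`-isogeny: `x ↦ (x⁴ + 8x³ + 54x² + 152x + 137)/(4(x+2)(x+3)²)`, padded with `g = X + 2` and rescaled by `λ = 2`:
  `U = (X⁴+8X³+54X²+152X+137)(X+2)`, `h = 2(X+2)(X+3)`, `S = (X⁵+13X⁴+34X³+2X²-67X-47)(X+2)`, `a = X⁴+8X³+54X²+152X+137`, `b = 4(X+2)(X+3)²`
  (Bézout `(116X²+704X+1072) a - (29X³+176X²+1225X+2038) b = 128`), degree `4`: on every `V/K` with `j(V) = 287496`, `r² = -1`, `σ₀ r = -r` ⊢
  `ψ` with the sign rules and `ψ ∘ ψ = [-4]`.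

THEOREMS ONLY (no definition, no named fact, no instance, no `sorry`); nothing about V2/V4 or any case of BSD is asserted; BSD is not proved by any
of this. Supports stmt-BirchSwinnertonDyer-21341 as a helper. The formulae of §§4–5 were computed by Vélu/composition in exact rational arithmetic
(session folder `kit/polycert.py`); only the kernel's `decide`/`ring` is relied on.

References: [SilvermanAdvancedTopics1994] II §2, Prop. II.2.3.1 (ii) (`[√-2]` on `y² = x³ + 4x² + 2x`), Thm. II.2.2(b), App. A §3;
[SilvermanAEC2009] III.4.8, Example III.4.5 (the `2`-isogeny), Remark III.4.13.3, Cor. III.6.3, Exercise 3.7(d), X.5 Prop. 5.4;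
[CremonaAlgorithms1997] §3.8, Table 1 (`32a`, `256a`).
-/

noncomputable section

open scoped Classical

open Polynomial WeierstrassCurve WeierstrassCurve.IsogenyFormula Field
  Literature.NumberTheory.EllipticCurves
  Literature.NumberTheory.EllipticCurves.PolyCert
  Literature.NumberTheory.EllipticCurves.DeuringModels
  Summit.BirchSwinnertonDyer.BirchSwinnertonDyer.Theorems.PrintCFram.SqrtEndomorphism
  Summit.BirchSwinnertonDyer.BirchSwinnertonDyer.Theorems.BiquadraticEisensteinDescentEisensteinHeartFlatCMInertBadKPrimeSqrtEndomorphism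
  Summit.BirchSwinnertonDyer.BirchSwinnertonDyer.Theorems.BiquadraticEisensteinDescentEisensteinHeartFlatCMInertBadKPrimeSqrtEndomorphismTwist

namespace Summit.BirchSwinnertonDyer.BirchSwinnertonDyer.Theorems.BiquadraticEisensteinDescentEisensteinHeartFlatCMInertBadKPrimeSqrtEndomorphismEven

universe u

/-! ## §1 The degree of an isogeny formula from a coprime representation of `U/h²` -/

section Degree

variable {K : Type u} [Field K] [CharZero K] {W₁ W₂ : WeierstrassCurve K} [W₁.IsElliptic] [W₂.IsElliptic]

/-- **`deg φ = max (deg a) (deg b)`** for the isogeny of an explicit formula `(U/h², (S y + T)/h³)` whenever `U = g·a`, `h² = g·b` over `K̄` with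
`a, b` coprime and `g ≠ 0`: `φ^* x' = U(x)/h(x)² = a(x)/b(x)` in `K̄(E₁)` (`g(x) ≠ 0`, `x` transcendental), and the tree's
`Isogeny.deg_eq_max_natDegree_of_pullbackX_eq`. The coprime case `g = 1`, `a = U`, `b = h²` is `IsogenyFormula.deg_toIsogeny`.
[cite: SilvermanAEC2009, Remark III.4.13.3 and Exercise 3.7(d)] -/
theorem deg_toIsogeny_of_repr (φ : IsogenyFormula W₁ W₂) {g a b : (AlgebraicClosure K)[X]} (hg : g ≠ 0) (hab : IsCoprime a b)
    (hU : φ.U.map (algebraMap K (AlgebraicClosure K)) = g * a)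
    (hh : (φ.h.map (algebraMap K (AlgebraicClosure K))) ^ 2 = g * b) :
    φ.toIsogeny.deg = max a.natDegree b.natDegree := by
  apply φ.toIsogeny.deg_eq_max_natDegree_of_pullbackX_eq hab
  have hg' : Polynomial.aeval W₁.genX g ≠ 0 := fun h0 ↦ transcendental_genX W₁ ⟨g, hg, h0⟩
  rw [φ.pullbackX_toIsogeny, hU, hh, map_mul, map_mul, mul_div_mul_left _ _ hg']

end Degree

/-! ## §2 `[√d] ∘ [√d] = [-n]` from `deg [√d] = n` -/

section CompSelf

variable {F : Type u} [Field F] [CharZero F] {W W' : WeierstrassCurve F} [W.IsElliptic]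
  (φ : IsogenyFormula W W') {d : F} (H : φ.IsTwistBy d) (r : F) (hr : r ^ 2 = d) (hr0 : r ≠ 0)

/-- **`deg [√d] = max (deg a) (deg b)`** for the twisted endomorphism `[√d] = τ ∘ φ` (`IsogenyFormula.sqrtEndo`) from a coprime representation
`U = g·a`, `h² = g·b` of the UNtwisted formula over `F̄`: twisting replaces `h` by `r·h`, i.e. `b` by the unit multiple `r²·b`.
[cite: SilvermanAEC2009, Remark III.4.13.3 and Exercise 3.7(d)] -/
theorem deg_sqrtEndo_of_repr {g a b : (AlgebraicClosure F)[X]} (hg : g ≠ 0) (hab : IsCoprime a b)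
    (hU : φ.U.map (algebraMap F (AlgebraicClosure F)) = g * a)
    (hh : (φ.h.map (algebraMap F (AlgebraicClosure F))) ^ 2 = g * b) :
    (φ.sqrtEndo H r hr hr0).deg = max a.natDegree b.natDegree := by
  have hrz : algebraMap F (AlgebraicClosure F) r ≠ 0 := (map_ne_zero_iff _ (algebraMap F _).injective).mpr hr0
  have hr2 : algebraMap F (AlgebraicClosure F) r ^ 2 ≠ 0 := pow_ne_zero 2 hrz
  have hdeg := deg_toIsogeny_of_repr (φ.twist H r hr (C_mul_cancel hr0)) (g := g) (a := a)
    (b := C (algebraMap F (AlgebraicClosure F) r ^ 2) * b) hg ?_ ?_ ?_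
  · change (φ.twist H r hr (C_mul_cancel hr0)).toIsogeny.deg = _
    rw [hdeg, natDegree_C_mul hr2]
  · refine IsCoprime.mul_right ⟨0, C (algebraMap F (AlgebraicClosure F) r ^ 2)⁻¹, ?_⟩ hab
    rw [zero_mul, zero_add, ← C_mul, inv_mul_cancel₀ hr2, C_1]
  · rw [twist_U, hU]
  · rw [twist_h, Polynomial.map_mul, map_C, mul_pow, ← C_pow, hh]; ring

variable (σ : AlgebraicClosure F ≃+* AlgebraicClosure F)
  (hσ : σ (algebraMap F _ r) = -algebraMap F _ r)
  (hσW : (W.baseChange (AlgebraicClosure F)).map σ.toRingHom = W.baseChange (AlgebraicClosure F))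
  (hσU : (φ.U.map (algebraMap F (AlgebraicClosure F))).map σ.toRingHom = φ.U.map (algebraMap F (AlgebraicClosure F)))
  (hσh : (φ.h.map (algebraMap F (AlgebraicClosure F))).map σ.toRingHom = φ.h.map (algebraMap F (AlgebraicClosure F)))
  (hσS : (φ.S.map (algebraMap F (AlgebraicClosure F))).map σ.toRingHom = φ.S.map (algebraMap F (AlgebraicClosure F)))

include hσ hσW hσU hσh hσS H in
/-- **`[√d] ∘ [√d] = [-n]` on `E(F̄)` from `deg [√d] = n > 0`.** With `f = [√d] ∈ End_F(E)`, Cor. III.6.3 gives `f ∘ f - t f + (deg f) = 0` for an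
integer `t` (`comp_self_sub_smul_add_smul_id_eq_zero`); conjugating by `σ` (which anti-commutes with `f`, `mapPoint_sqrtEndo`) gives
`f ∘ f + t f + (deg f) = 0`, hence `2t f = 0`, `t = 0` (degrees: `4t² n = 0`, `n > 0`), and `f ∘ f = -(deg f) = -n`. This is the tree's
`IsogenyFormula.sqrtEndo_comp_self` with the degree as a HYPOTHESIS (there: `deg U` via coprimality). [cite: SilvermanAEC2009, Cor. III.6.3]
[cite: SilvermanAdvancedTopics1994, II §2, Prop. II.2.3.1] -/
theorem sqrtEndo_comp_self_of_deg {n : ℕ} (hn : 0 < n) (hdeg : (φ.sqrtEndo H r hr hr0).deg = n) (P : W.geomPoints) :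
    φ.sqrtEndo H r hr hr0 (φ.sqrtEndo H r hr hr0 P) = -((n : ℤ) • P) := by
  set ψ := φ.sqrtEndo H r hr hr0 with hψ
  set f : W.geomPoints →+ W.geomPoints := ψ.toAddMonoidHom with hf_def
  set S : W.geomPoints →+ W.geomPoints := mapPoint σ.toRingHom hσW with hS
  have h63 := degHom_isQuadraticForm_holds W W
  have hid : ∀ (m : ℤ) (g : W.geomPoints →+ W.geomPoints) (Q : W.geomPoints), (m • g) Q = m • g Q := fun _ _ _ ↦ rfl
  have hf : f ∈ homModule W W := ψ.toAddMonoidHom_mem_homModule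
  have hN : degHom W W f = (n : ℤ) := by rw [hf_def, degHom_toAddMonoidHom, hψ, hdeg]
  -- Cayley–Hamilton: `f² - t f + N = 0`
  set t : ℤ := degHom W W (f + AddMonoidHom.id W.geomPoints) - degHom W W f - 1 with ht
  have hCH : f.comp f - t • f + degHom W W f • AddMonoidHom.id W.geomPoints = 0 :=
    comp_self_sub_smul_add_smul_id_eq_zero h63 hf
  -- conjugation: `S f = -f S`, `S` surjective
  have hanti : S.comp f = -(f.comp S) := by
    ext Q
    exact φ.mapPoint_sqrtEndo H r hr hr0 σ hσ hσW hσU hσh hσS Q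
  have hSsurj : Function.Surjective S := mapPoint_surjective σ.toRingHom hσW σ.surjective
  have hCH' : f.comp f + t • f + degHom W W f • AddMonoidHom.id W.geomPoints = 0 := by
    have h1 : S.comp (f.comp f - t • f + degHom W W f • AddMonoidHom.id W.geomPoints) =
        (f.comp f + t • f + degHom W W f • AddMonoidHom.id W.geomPoints).comp S := by
      ext Q
      have e1 : S (f (f Q)) = f (f (S Q)) := by
        have := congrArg (fun g : W.geomPoints →+ W.geomPoints ↦ g (f Q)) hanti
        simp only [AddMonoidHom.comp_apply, AddMonoidHom.neg_apply] at this
        rw [this]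
        have := congrArg (fun g : W.geomPoints →+ W.geomPoints ↦ g Q) hanti
        simp only [AddMonoidHom.comp_apply, AddMonoidHom.neg_apply] at this
        rw [this, map_neg, neg_neg]
      have e2 : S (f Q) = -f (S Q) := by
        have := congrArg (fun g : W.geomPoints →+ W.geomPoints ↦ g Q) hanti
        simpa only [AddMonoidHom.comp_apply, AddMonoidHom.neg_apply] using this
      simp only [AddMonoidHom.comp_apply, AddMonoidHom.add_apply, AddMonoidHom.sub_apply,
        hid, AddMonoidHom.id_apply, map_add, map_sub, map_zsmul, e1, e2, smul_neg, sub_neg_eq_add]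
    rw [hCH, AddMonoidHom.comp_zero] at h1
    exact ((AddMonoidHom.cancel_right hSsurj).mp (h1.symm.trans (AddMonoidHom.zero_comp S).symm))
  -- hence `2t f = 0`, so `t = 0`
  have h2t : (2 * t) • f = 0 := by
    have := congrArg₂ (· - ·) hCH' hCH
    simp only [sub_zero] at this
    rw [← this]; module
  have ht0 : t = 0 := by
    have h1 := degHom_zsmul h63 hf (2 * t)
    rw [h2t, degHom_zero, hN] at h1
    have hpos : (0 : ℤ) < n := by exact_mod_cast hn
    have : (2 * t) ^ 2 = 0 := by
      rcases mul_eq_zero.mp h1.symm with h | h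
      · exact h
      · exact absurd h hpos.ne'
    simpa using this
  -- conclude
  rw [ht0, zero_smul, sub_zero, hN] at hCH
  have := congrArg (fun g : W.geomPoints →+ W.geomPoints ↦ g P) hCH
  simp only [AddMonoidHom.add_apply, AddMonoidHom.comp_apply, hid, AddMonoidHom.zero_apply] at this
  rw [← eq_neg_iff_add_eq_zero] at this
  exact this

end CompSelf

/-! ## §3 The Galois-action form over a base `F ∌ √d`, from a coprime representation -/

section Main

variable {F : Type u} [Field F] [CharZero F] {W W' : WeierstrassCurve F} [hW : W.IsElliptic]

/-- **`[√d]` on `E(F̄)` over a base `F ∌ √d`, even-degree-capable form.** Let `φ : W → W′` be an isogeny formula over `F` with twisting data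
`IsTwistBy d`, a representation `U = g·a`, `h² = g·b` over `F` with `a, b` coprime, `g ≠ 0` and `n = max (deg a) (deg b) > 0`, `r ∈ F̄` with
`r² = d`, and `σ₀ ∈ Γ_F` with `σ₀ r = -r`. Then there is an additive endomorphism `ψ` of `E(F̄)` with `σ • ψ P = ψ (σ • P)` whenever `σ r = r`,
`σ • ψ P = -ψ (σ • P)` whenever `σ r = -r`, and `ψ (ψ P) = -(n • P)`. (w1's `exists_sqrt_endomorphism` is the case `g = 1`, `n = deg U`.)
[cite: SilvermanAdvancedTopics1994, II §2, Prop. II.2.3.1 and Thm. II.2.2(b)] [cite: SilvermanAEC2009, Cor. III.6.3] -/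
theorem exists_sqrt_endomorphism_of_repr (φ : IsogenyFormula W W') {d : F} (H : φ.IsTwistBy d)
    {g a b : F[X]} (hg : g ≠ 0) (hab : IsCoprime a b) (hU : φ.U = g * a) (hh : φ.h ^ 2 = g * b)
    {n : ℕ} (hn : 0 < n) (hnab : max a.natDegree b.natDegree = n)
    (r : AlgebraicClosure F) (hr : r ^ 2 = algebraMap F (AlgebraicClosure F) d) (hr0 : r ≠ 0)
    (σ₀ : absoluteGaloisGroup F) (hσ₀ : σ₀ • r = -r) :
    ∃ ψ : W.geomPoints →+ W.geomPoints,
      (∀ σ : absoluteGaloisGroup F, σ • r = r → ∀ P : W.geomPoints, σ • ψ P = ψ (σ • P)) ∧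
      (∀ σ : absoluteGaloisGroup F, σ • r = -r → ∀ P : W.geomPoints, σ • ψ P = -ψ (σ • P)) ∧
      (∀ P : W.geomPoints, ψ (ψ P) = -((n : ℤ) • P)) := by
  -- notation: `Ω = F̄`, `Ωb = \overline{F̄}`
  haveI : CharZero (AlgebraicClosure F) := charZero_of_injective_algebraMap (algebraMap F _).injective
  haveI hWΩ : (W.baseChange (AlgebraicClosure F)).IsElliptic := inferInstanceAs (W.map (algebraMap F (AlgebraicClosure F))).IsElliptic
  let ι := algebraMap F (AlgebraicClosure F)
  let ι₂ := algebraMap (AlgebraicClosure F) (AlgebraicClosure (AlgebraicClosure F))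
  let φΩ : IsogenyFormula (W.baseChange (AlgebraicClosure F)) (W'.baseChange (AlgebraicClosure F)) := φ.map ι ι.injective
  have HΩ : φΩ.IsTwistBy (ι d) := isTwistBy_map φ H _ ι.injective
  let χ : Isogeny (W.baseChange (AlgebraicClosure F)) (W.baseChange (AlgebraicClosure F)) := φΩ.sqrtEndo HΩ r hr hr0
  let e := W.geomPointsBaseChangeEquiv
  let ψ : W.geomPoints →+ W.geomPoints := e.symm.toAddMonoidHom.comp (χ.toAddMonoidHom.comp e.toAddMonoidHom)
  have hψ : ∀ P, ψ P = e.symm (χ (e P)) := fun _ ↦ rfl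
  -- the representation read in `\overline{F̄}`
  have hg₂ : (g.map ι).map ι₂ ≠ 0 := by
    rw [Polynomial.map_ne_zero_iff ι₂.injective, Polynomial.map_ne_zero_iff ι.injective]; exact hg
  have hab₂ : IsCoprime ((a.map ι).map ι₂) ((b.map ι).map ι₂) := (hab.map (mapRingHom ι)).map (mapRingHom ι₂)
  have hU₂ : (φΩ.U).map ι₂ = (g.map ι).map ι₂ * (a.map ι).map ι₂ := by
    change ((φ.U.map ι).map ι₂) = _
    rw [hU, Polynomial.map_mul, Polynomial.map_mul]
  have hh₂ : ((φΩ.h).map ι₂) ^ 2 = (g.map ι).map ι₂ * (b.map ι).map ι₂ := by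
    change ((φ.h.map ι).map ι₂) ^ 2 = _
    rw [← Polynomial.map_pow, ← Polynomial.map_pow, hh, Polynomial.map_mul, Polynomial.map_mul]
  have hdeg : χ.deg = n := by
    rw [deg_sqrtEndo_of_repr φΩ HΩ r hr hr0 hg₂ hab₂ hU₂ hh₂, natDegree_map_eq_of_injective ι₂.injective,
      natDegree_map_eq_of_injective ι₂.injective, natDegree_map_eq_of_injective ι.injective,
      natDegree_map_eq_of_injective ι.injective, hnab]
  -- anti-commutation with every `τ` moving `r`
  have hanti : ∀ τ : absoluteGaloisGroup F, τ • r = -r → ∀ Q : W.geomPoints, τ • ψ Q = -ψ (τ • Q) := by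
    intro τ hτ Q
    obtain ⟨τ', hτ'⟩ := exists_ringEquiv_lift τ
    have hτr : τ' (ι₂ r) = -ι₂ r := by rw [hτ', hτ, map_neg]
    have hτU : ((φΩ.U).map ι₂).map τ'.toRingHom = (φΩ.U).map ι₂ := map_map_map_eq φ.U τ τ' hτ'
    have hτh : ((φΩ.h).map ι₂).map τ'.toRingHom = (φΩ.h).map ι₂ := map_map_map_eq φ.h τ τ' hτ'
    have hτS : ((φΩ.S).map ι₂).map τ'.toRingHom = (φΩ.S).map ι₂ := map_map_map_eq φ.S τ τ' hτ'
    have key := φΩ.mapPoint_sqrtEndo HΩ r hr hr0 τ' hτr (map_baseChange_baseChange_eq W τ τ' hτ') hτU hτh hτS (e Q)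
    apply e.injective
    rw [geomPointsBaseChangeEquiv_smul W τ τ' hτ', hψ, e.apply_symm_apply, map_neg, hψ, e.apply_symm_apply,
      geomPointsBaseChangeEquiv_smul W τ τ' hτ']
    exact key
  -- `ψ ∘ ψ = [-n]`
  have hsq : ∀ P : W.geomPoints, ψ (ψ P) = -((n : ℤ) • P) := by
    intro P
    obtain ⟨σ', hσ'⟩ := exists_ringEquiv_lift σ₀
    have hσr : σ' (ι₂ r) = -ι₂ r := by rw [hσ', hσ₀, map_neg]
    have hσU : ((φΩ.U).map ι₂).map σ'.toRingHom = (φΩ.U).map ι₂ := map_map_map_eq φ.U σ₀ σ' hσ'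
    have hσh : ((φΩ.h).map ι₂).map σ'.toRingHom = (φΩ.h).map ι₂ := map_map_map_eq φ.h σ₀ σ' hσ'
    have hσS : ((φΩ.S).map ι₂).map σ'.toRingHom = (φΩ.S).map ι₂ := map_map_map_eq φ.S σ₀ σ' hσ'
    have key := sqrtEndo_comp_self_of_deg φΩ HΩ r hr hr0 σ' hσr (map_baseChange_baseChange_eq W σ₀ σ' hσ') hσU hσh hσS hn hdeg (e P)
    apply e.injective
    rw [hψ, e.apply_symm_apply, hψ, e.apply_symm_apply, map_neg, map_zsmul]
    exact key
  exact ⟨ψ, fun σ hσ P ↦ smul_comm_of_forall_smul_anticomm ψ r hanti σ₀ hσ₀ σ hσ P, hanti, hsq⟩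

end Main

/-! ## §4 `j = 8000`: the `2`-isogeny `[0,0,0,-30,56] → [0,0,0,-120,-448] = E^{(-2)}`, padded -/

section Even

variable {K : Type} [Field K] [CharZero K]

/-- From an (inline) certificate with twisting data (short models, `a₄' = d² a₄`, `a₆' = d³ a₆`, `T = 0` — the fields of
`DeuringCert.IsCMTwistCert` except monicity and `deg U = -d`, which fail for padded even-degree data) and a coprime representation
`U = g a`, `h² = g b` to EVERY curve with the model's `j`-invariant (`j ≠ 0, 1728`):
§3 on the certified model over `K` + w1's quadratic-twist transport `…SqrtEndomorphismTwist.exists_endomorphism_of_j_eq`.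
[cite: SilvermanAdvancedTopics1994, II §2, Prop. II.2.3.1 and Thm. II.2.2(b)] [cite: SilvermanAEC2009, X.5 Prop. 5.4] -/
theorem exists_endomorphism_of_cert_of_repr {c : IsogenyCert} {d : ℤ} (hc : c.check = true)
    (H₁ : c.a₁ = 0) (H₂ : c.a₂ = 0) (H₃ : c.a₃ = 0) (H₁' : c.a₁' = 0) (H₂' : c.a₂' = 0) (H₃' : c.a₃' = 0)
    (H₄' : c.a₄' = d ^ 2 * c.a₄) (H₆' : c.a₆' = d ^ 3 * c.a₆) (HT : c.T = [])
    {g a b : K[X]} (hg : g ≠ 0) (hab : IsCoprime a b) (hU : (ofList c.U : K[X]) = g * a) (hh : (ofList c.h : K[X]) ^ 2 = g * b)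
    {n : ℕ} (hn : 0 < n) (hnab : max a.natDegree b.natDegree = n) {m : ℤ}
    (hmodel : (DeuringCert.curve c).c₄ ^ 3 = m * (DeuringCert.curve c).Δ)
    (hΔ : (DeuringCert.curve c).Δ ≠ 0) (hm0 : m ≠ 0) (hm1728 : m ≠ 1728)
    (r : AlgebraicClosure K) (hr : r ^ 2 = algebraMap K (AlgebraicClosure K) (d : K)) (hr0 : r ≠ 0)
    (σ₀ : absoluteGaloisGroup K) (hσ₀ : σ₀ • r = -r) (V : WeierstrassCurve K) [V.IsElliptic] (hj : V.j = (m : K)) :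
    ∃ f : V.geomPoints →+ V.geomPoints,
      (∀ σ : absoluteGaloisGroup K, σ • r = r → ∀ P, σ • f P = f (σ • P)) ∧
      (∀ σ : absoluteGaloisGroup K, σ • r = -r → ∀ P, σ • f P = -f (σ • P)) ∧
      (∀ P, f (f P) = (-(n : ℤ)) • P) := by
  haveI hE := isElliptic_map_intCast (DeuringCert.curve c) K hΔ
  haveI : ((DeuringCert.curve c).map (Int.castRingHom K)).IsCharNeTwoNF :=
    ⟨by change (Int.castRingHom K) c.a₁ = 0; rw [H₁, map_zero], by change (Int.castRingHom K) c.a₃ = 0; rw [H₃, map_zero]⟩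
  have hjE := j_map_intCast_of_c₄_pow (DeuringCert.curve c) K m hmodel
  set E := (DeuringCert.curve c).map (Int.castRingHom K) with hEdef
  set E' := (DeuringCert.curve' c).map (Int.castRingHom K) with hE'def
  let φ : IsogenyFormula E E' := c.toFormula hc E E' rfl rfl
  have HK : φ.IsTwistBy (d : K) :=
    { a₁ := by change (Int.castRingHom K) c.a₁ = 0; rw [H₁, map_zero]
      a₂ := by change (Int.castRingHom K) c.a₂ = 0; rw [H₂, map_zero]
      a₃ := by change (Int.castRingHom K) c.a₃ = 0; rw [H₃, map_zero]
      a₁' := by change (Int.castRingHom K) c.a₁' = 0; rw [H₁', map_zero]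
      a₂' := by change (Int.castRingHom K) c.a₂' = 0; rw [H₂', map_zero]
      a₃' := by change (Int.castRingHom K) c.a₃' = 0; rw [H₃', map_zero]
      a₄' := by
        change (Int.castRingHom K) c.a₄' = _ * (Int.castRingHom K) c.a₄
        rw [H₄', map_mul, map_pow, eq_intCast]
      a₆' := by
        change (Int.castRingHom K) c.a₆' = _ * (Int.castRingHom K) c.a₆
        rw [H₆', map_mul, map_pow, eq_intCast]
      T := by change (ofList c.T : K[X]) = 0; rw [HT]; rfl }
  obtain ⟨ψ, h1, h2, h3⟩ := exists_sqrt_endomorphism_of_repr φ HK hg hab hU hh hn hnab r hr hr0 σ₀ hσ₀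
  refine exists_endomorphism_of_j_eq (by rw [hjE]; exact_mod_cast hm0) (by rw [hjE]; exact_mod_cast hm1728) r ψ h1 h2
    (fun P ↦ by rw [h3, neg_zsmul]) V (by rw [hj, hjE])

/-- **`[√-2]` in sign form on EVERY elliptic curve with `j = 8000` over `K ∌ √-2`** (`char K = 0`): for `V/K` with `j(V) = 8000`, `r ∈ K̄` with
`r² = -2` and `σ₀ ∈ Γ_K` with `σ₀ r = -r`, an additive `ψ` on `V(K̄)` with `σ • ψ P = ψ (σ • P)` for `σ r = r`, `σ • ψ P = -ψ (σ • P)` for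
`σ r = -r`, and `ψ (ψ P) = (-2) • P`. Certificate (inline): the `2`-isogeny of `E = [0,0,0,-30,56]` with kernel `⟨(4,0)⟩` onto `E^{(-2)}`,
padded (`U = (X² - 4X + 18)(X - 4)`, `h = X - 4`, `S = (X² - 8X - 2)(X - 4)`); degree `2 = max (deg (X² - 4X + 18)) (deg (X - 4))`.
[cite: SilvermanAdvancedTopics1994, II §2, Prop. II.2.3.1 (ii) and App. A §3] [cite: SilvermanAEC2009, Example III.4.5 and Cor. III.6.3] -/
theorem exists_sqrt_endomorphism_of_j_eq_8000 (V : WeierstrassCurve K) [V.IsElliptic] (hj : V.j = 8000)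
    (r : AlgebraicClosure K) (hr : r ^ 2 = -2) (σ₀ : absoluteGaloisGroup K) (hσ₀ : σ₀ • r = -r) :
    ∃ ψ : V.geomPoints →+ V.geomPoints,
      (∀ σ : absoluteGaloisGroup K, σ • r = r → ∀ P, σ • ψ P = ψ (σ • P)) ∧
      (∀ σ : absoluteGaloisGroup K, σ • r = -r → ∀ P, σ • ψ P = -ψ (σ • P)) ∧
      (∀ P, ψ (ψ P) = (-2 : ℤ) • P) := by
  have hr' : r ^ 2 = algebraMap K (AlgebraicClosure K) (((-2 : ℤ) : K)) := by
    rw [hr, Int.cast_neg, Int.cast_ofNat, map_neg, map_ofNat]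
  have hr0 : r ≠ 0 := by rintro rfl; norm_num at hr
  have h18 : (18 : K) ≠ 0 := by norm_num
  have hab : IsCoprime (X ^ 2 - 4 * X + 18 : K[X]) (X - 4) := by
    refine ⟨C (18 : K)⁻¹, -(C (18 : K)⁻¹ * X), ?_⟩
    calc C (18 : K)⁻¹ * (X ^ 2 - 4 * X + 18 : K[X]) + -(C (18 : K)⁻¹ * X) * (X - 4) = C (18 : K)⁻¹ * 18 := by ring
      _ = 1 := by rw [← map_ofNat C 18, ← C_mul, inv_mul_cancel₀ h18, C_1]
  have hna : (X ^ 2 - 4 * X + 18 : K[X]).natDegree = 2 := by compute_degree!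
  have hnb : (X - 4 : K[X]).natDegree = 1 := by compute_degree!
  have hg : (X - 4 : K[X]) ≠ 0 := fun h0 ↦ by
    have := congrArg (Polynomial.eval 0) h0
    norm_num at this
  obtain ⟨f, h1, h2, h3⟩ := exists_endomorphism_of_cert_of_repr
    (c := ⟨0, 0, 0, -30, 56, 0, 0, 0, -120, -448, [-72, 34, -8, 1], [-4, 1], [8, 30, -12, 1], []⟩) (d := -2)
    (by decide +kernel) rfl rfl rfl rfl rfl rfl (by decide) (by decide) rfl
    (g := X - 4) (a := X ^ 2 - 4 * X + 18) (b := X - 4) hg hab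
    (by simp only [ofList_cons, ofList_nil]; push_cast; simp only [map_neg, map_ofNat, map_one]; ring)
    (by simp only [ofList_cons, ofList_nil]; push_cast; simp only [map_neg, map_ofNat, map_one]; ring)
    (n := 2) two_pos (by rw [hna, hnb]; rfl)
    (m := 8000) (by decide) (by decide) (by norm_num) (by norm_num) r hr' hr0 σ₀ hσ₀ V (by rw [hj]; norm_num)
  exact ⟨f, h1, h2, fun P ↦ by rw [h3]; norm_num⟩

/-! ## §5 `j = 287496`: the cyclic `4`-isogeny `32a3 = [0,0,0,-11,-14] → [0,0,0,-11,14] = 32a4 = E^{(-1)}`, padded and rescaled -/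

/-- **`[2i] = [√-4]` in sign form on EVERY elliptic curve with `j = 287496` over `K ∌ i`** (`char K = 0`): for `V/K` with `j(V) = 287496`,
`r ∈ K̄` with `r² = -1` and `σ₀ ∈ Γ_K` with `σ₀ r = -r`, an additive `ψ` on `V(K̄)` with `σ • ψ P = ψ (σ • P)` for `σ r = r`,
`σ • ψ P = -ψ (σ • P)` for `σ r = -r`, and `ψ (ψ P) = (-4) • P`. Certificate (inline): the cyclic `4`-isogeny of `E = [0,0,0,-11,-14]` with kernel
`E[2i] ∋ (-2, 0), (-3, ±2√-2)` onto `E^{(-1)} = [0,0,0,-11,14]`, `x ↦ (x⁴+8x³+54x²+152x+137)/(4(x+2)(x+3)²)`, padded by `g = X + 2` and rescaled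
by `2`: `U = (X⁴+8X³+54X²+152X+137)(X+2)`, `h = 2(X+2)(X+3)`, `S = (X⁵+13X⁴+34X³+2X²-67X-47)(X+2)`; degree
`4 = max (deg (X⁴+…+137)) (deg (4(X+2)(X+3)²))`. [cite: SilvermanAdvancedTopics1994, II §2, Thm. II.2.2(b) and App. A §3]
[cite: SilvermanAEC2009, Remark III.4.13.3 and Cor. III.6.3] -/
theorem exists_sqrt_endomorphism_of_j_eq_287496 (V : WeierstrassCurve K) [V.IsElliptic] (hj : V.j = 287496)
    (r : AlgebraicClosure K) (hr : r ^ 2 = -1) (σ₀ : absoluteGaloisGroup K) (hσ₀ : σ₀ • r = -r) :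
    ∃ ψ : V.geomPoints →+ V.geomPoints,
      (∀ σ : absoluteGaloisGroup K, σ • r = r → ∀ P, σ • ψ P = ψ (σ • P)) ∧
      (∀ σ : absoluteGaloisGroup K, σ • r = -r → ∀ P, σ • ψ P = -ψ (σ • P)) ∧
      (∀ P, ψ (ψ P) = (-4 : ℤ) • P) := by
  have hr' : r ^ 2 = algebraMap K (AlgebraicClosure K) (((-1 : ℤ) : K)) := by
    rw [hr, Int.cast_neg, Int.cast_one, map_neg, map_one]
  have hr0 : r ≠ 0 := by rintro rfl; norm_num at hr
  have h128 : (128 : K) ≠ 0 := by norm_num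
  have hab : IsCoprime (X ^ 4 + 8 * X ^ 3 + 54 * X ^ 2 + 152 * X + 137 : K[X]) (4 * X ^ 3 + 32 * X ^ 2 + 84 * X + 72) := by
    refine ⟨C (128 : K)⁻¹ * (116 * X ^ 2 + 704 * X + 1072), -(C (128 : K)⁻¹ * (29 * X ^ 3 + 176 * X ^ 2 + 1225 * X + 2038)), ?_⟩
    calc C (128 : K)⁻¹ * (116 * X ^ 2 + 704 * X + 1072) * (X ^ 4 + 8 * X ^ 3 + 54 * X ^ 2 + 152 * X + 137 : K[X]) +
          -(C (128 : K)⁻¹ * (29 * X ^ 3 + 176 * X ^ 2 + 1225 * X + 2038)) * (4 * X ^ 3 + 32 * X ^ 2 + 84 * X + 72)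
          = C (128 : K)⁻¹ * 128 := by ring
      _ = 1 := by rw [← map_ofNat C 128, ← C_mul, inv_mul_cancel₀ h128, C_1]
  have hna : (X ^ 4 + 8 * X ^ 3 + 54 * X ^ 2 + 152 * X + 137 : K[X]).natDegree = 4 := by compute_degree!
  have hnb : (4 * X ^ 3 + 32 * X ^ 2 + 84 * X + 72 : K[X]).natDegree = 3 := by compute_degree!
  have hg : (X + 2 : K[X]) ≠ 0 := fun h0 ↦ by
    have := congrArg (Polynomial.eval 0) h0
    norm_num at this
  obtain ⟨f, h1, h2, h3⟩ := exists_endomorphism_of_cert_of_repr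
    (c := ⟨0, 0, 0, -11, -14, 0, 0, 0, -11, 14, [274, 441, 260, 70, 10, 1], [12, 10, 2], [-94, -181, -63, 70, 60, 15, 1], []⟩) (d := -1)
    (by decide +kernel) rfl rfl rfl rfl rfl rfl (by decide) (by decide) rfl
    (g := X + 2) (a := X ^ 4 + 8 * X ^ 3 + 54 * X ^ 2 + 152 * X + 137) (b := 4 * X ^ 3 + 32 * X ^ 2 + 84 * X + 72) hg hab
    (by simp only [ofList_cons, ofList_nil]; push_cast; simp only [map_ofNat, map_one]; ring)
    (by simp only [ofList_cons, ofList_nil]; push_cast; simp only [map_ofNat]; ring)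
    (n := 4) four_pos (by rw [hna, hnb]; rfl)
    (m := 287496) (by decide) (by decide) (by norm_num) (by norm_num) r hr' hr0 σ₀ hσ₀ V (by rw [hj]; norm_num)
  exact ⟨f, h1, h2, fun P ↦ by rw [h3]; norm_num⟩

end Even

end Summit.BirchSwinnertonDyer.BirchSwinnertonDyer.Theorems.BiquadraticEisensteinDescentEisensteinHeartFlatCMInertBadKPrimeSqrtEndomorphismEven

end
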